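import Literature.MathematicalPhysics.QuantumLattice.SlaterKosterTwoCentre
import Mathlib.Data.Matrix.Block
import Mathlib.LinearAlgebra.Matrix.Determinant.Basic
import Mathlib.Analysis.SpecialFunctions.Integrals.Basic

/-!
# The bilayer two-orbital (`d_{x²−y²}`, `d_{3z²−r²}`) Bloch matrix of La₃Ni₂O₇-type nickelates:
# block structure, exact bonding/antibonding reduction, the `d`-wave form factor of the `e_g`
# hybridisation from the Slater–Koster signs, closed-form two-level bands, the printed parameter set

Luo, Hu, Wang, Wú and Yao downfold the high-pressure phase of the Ruddlesden–Popper bilayer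
La₃Ni₂O₇ onto Ni `d_{x²−y²}` (`x`) and `d_{3z²−r²}` (`z`) Wannier orbitals on the two layers `A, B`
[LuoEtAl2023, Eqs. (1)–(2)]: in the basis `(Ax, Az, Bx, Bz)`
`H(k) = [[H_A, H_AB], [H_AB, H_A]]`, `H_A = [[T^x_k, V_k], [V_k, T^z_k]]`,
`H_AB = [[t^x_⊥, V′_k], [V′_k, t^z_⊥]]`, with
`T^{x/z}_k = 2t₁^{x/z}(cos k_x + cos k_y) + 4t₂^{x/z} cos k_x cos k_y + ε^{x/z}`,
`V_k = 2t₃^{xz}(cos k_x − cos k_y)`, `V′_k = 2t₄^{xz}(cos k_x − cos k_y)`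
(«the minus sign … in the structure factor of `t₃^{xz}, t₄^{xz}` is associated to the orbital
symmetry of two `e_g` sectors»), and «the mirror symmetry of the bilayer structure allows us to define
the bonding and anti-bonding states `Φ_± = (d_A ± d_B)/√2`», in which `H₀` is block diagonal with
`H_±(k) = [[T^x_k ± t^x_⊥, V_k ± V′_k], [V_k ± V′_k, T^z_k ± t^z_⊥]]` and «the two `d_{3z²−r²}` states
at `E_F` … define a splitting energy `2t^z_⊥`» [LuoEtAl2023, Eq. (3)]; Table I prints
`t₁^x = −0.483, t₁^z = −0.110, t₂^x = 0.069, t₂^z = −0.017, t₃^{xz} = 0.239, t^x_⊥ = 0.005,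
t^z_⊥ = −0.635, t₄^{xz} = −0.034, ε^x = 0.776, ε^z = 0.409` eV («`t^z_⊥` … larger than … `t₁^x` …
by a ratio of 1.3»; «for `d_{x²−y²}` the amplitude `t^x_⊥ = 0.005` is marginal»).

This file types that model as the TARGET OBJECT of the router's `UND:MULTIORB` branch for the
bilayer nickelates and proves the exact statements around it:

* §1 the form factors `γ_s = cos k_x + cos k_y`, `γ_d = cos k_x − cos k_y`, their bounds and zeros
  (`γ_d = 0` on the zone diagonals `k_y = ±k_x`), the entries `T, V` and the `4 × 4` matrix
  `H = fromBlocks H_A H_AB H_AB H_A`.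
* §2 the MIRROR REDUCTION as a matrix identity for ANY square blocks `A, B` (no commutation needed):
  with `P = fromBlocks 1 1 1 (−1)` (`P² = 2·1`, `Pᵀ = P`), `P (fromBlocks A B B A) P = 2·fromBlocks
  (A+B) 0 0 (A−B)`; and the sector statement `H (v, ±v) = ((A ± B)v, ±(A ± B)v)`. Hence
  `H_± = H_A ± H_AB` with exactly the printed entries.
* §3 the symmetric two-level problem `[[a, v], [v, b]]` in closed form (`λ_± = (a+b)/2 ± √(((a−b)/2)² +
  v²)`: trace, determinant, characteristic equation, `λ_− ≤ min(a,b) ≤ max(a,b) ≤ λ_+`, splitting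
  `≥ |a − b|`, decoupling at `v = 0`) = the bands of each sector.
* §4 consequences: on the zone diagonals the sectors are already diagonal, so the four bands there are
  exactly `T^x ± t^x_⊥`, `T^z ± t^z_⊥`; the `z` bonding–antibonding splitting of the diagonal
  entries is `2t^z_⊥` at every `k`.
* §5 WHY `γ_d` (from `SlaterKosterTwoCentre`): on a straight `x` bond the oxygen-mediated `x–z`
  product `E_{p,x²−y²}E_{p,3z²−r²}` has the OPPOSITE sign to the `y` bond while `x–x` and `z–z`
  products have the SAME sign, and likewise for the direct `d–d` Slater–Koster elements; a
  nearest-neighbour Bloch sum with amplitudes `(t, t)` on `x, y` bonds is `2t γ_s`, with `(t, −t)` it is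
  `2t γ_d`.
* §6 the printed Table I as a record with the printed comparisons checked (`|t^z_⊥/t₁^x| ∈
  (1.31, 1.32)`, `2|t^z_⊥| = 1.27` eV, `|t^x_⊥| < 1 % of |t^z_⊥|` — the apical `p_z` path feeds
  `d_{3z²−r²}` only, `SlaterKoster.apical`).

* §7 ZONE AVERAGES over the square Brillouin zone `[0, 2π]²` as exact iterated period integrals:
  `⟨γ_s⟩ = ⟨γ_d⟩ = ⟨cos k_x cos k_y⟩ = 0`, `⟨γ_s²⟩ = ⟨γ_d²⟩ = 1`, `⟨γ_s γ_d⟩ = 0`; hence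
  `⟨T^{x/z}_k⟩ = ε^{x/z}` (the site energies are the band centres of gravity), `⟨V_k²⟩ = 4t₃²`
  (rms hybridisation `2|t₃|` = half its maximum `4|t₃|` at `X`), and `⟨((cos k_x − cos k_y)/2)²⟩ = ¼`.

Everything PROVED; 0 facts; no `sorry`.  NOT here: the interaction `H_U` beyond its statement in
the docstring, Fermi surfaces, fillings, pairing, any DFT number beyond the quoted Table I, the
orthorhombic distortion («γ pocket slightly stretched»).

References: Z. Luo, X. Hu, M. Wang, W. Wú, D.-X. Yao, Phys. Rev. Lett. 131 (2023) 126001,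
arXiv:2305.15564, Eqs. (1)–(3) and Table I (held text p0002); J. C. Slater, G. F. Koster, Phys.
Rev. 94 (1954) 1498, Table I (via `SlaterKosterTwoCentre.lean`).  AI-produced formalisation (H21,
cell hubbard-downfold, seat lit-1, 2026-08-27).
-/

noncomputable section

namespace Literature.MathematicalPhysics.QuantumLattice

namespace BilayerTwoOrbital

open Real Matrix MeasureTheory intervalIntegral

/-! ## 1. Form factors, entries, the `4 × 4` Bloch matrix -/

/-- `γ_s(k) = cos k_x + cos k_y`. [cite: LuoEtAl2023, Eq. (2)] -/
def γs (kx ky : ℝ) : ℝ := cos kx + cos ky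

/-- `γ_d(k) = cos k_x − cos k_y`. [cite: LuoEtAl2023, Eq. (2)] -/
def γd (kx ky : ℝ) : ℝ := cos kx - cos ky

/-- `|γ_s| ≤ 2`. [cite: LuoEtAl2023, Eq. (2)] -/
theorem abs_γs_le (kx ky : ℝ) : |γs kx ky| ≤ 2 := by
  rw [γs, abs_le]
  have h1 := abs_le.mp (abs_cos_le_one kx)
  have h2 := abs_le.mp (abs_cos_le_one ky)
  constructor <;> linarith [h1.1, h1.2, h2.1, h2.2]

/-- `|γ_d| ≤ 2`. [cite: LuoEtAl2023, Eq. (2)] -/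
theorem abs_γd_le (kx ky : ℝ) : |γd kx ky| ≤ 2 := by
  rw [γd, abs_le]
  have h1 := abs_le.mp (abs_cos_le_one kx)
  have h2 := abs_le.mp (abs_cos_le_one ky)
  constructor <;> linarith [h1.1, h1.2, h2.1, h2.2]

/-- `γ_d` vanishes on the zone diagonal `k_y = k_x` … [cite: LuoEtAl2023, Eq. (2)] -/
theorem γd_diag (k : ℝ) : γd k k = 0 := by simp [γd]

/-- … and on the anti-diagonal `k_y = −k_x`. [cite: LuoEtAl2023, Eq. (2)] -/
theorem γd_antidiag (k : ℝ) : γd k (-k) = 0 := by simp [γd, cos_neg]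

/-- At `Γ`: `γ_s = 2`, `γ_d = 0`; at `X = (π, 0)`: `γ_s = 0`, `γ_d = −2`; at `M = (π, π)`: `γ_s = −2`,
`γ_d = 0`. [cite: LuoEtAl2023, Eq. (2)] -/
theorem γ_special :
    γs 0 0 = 2 ∧ γd 0 0 = 0 ∧ γs π 0 = 0 ∧ γd π 0 = -2 ∧ γs π π = -2 ∧ γd π π = 0 := by
  simp only [γs, γd, cos_zero, cos_pi]; norm_num

/-- Intra-orbital intra-layer dispersion `T_k = 2t₁ γ_s + 4t₂ cos k_x cos k_y + ε`. [cite: LuoEtAl2023, Eq. (2)] -/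
def T (t1 t2 ε kx ky : ℝ) : ℝ := 2 * t1 * γs kx ky + 4 * t2 * (cos kx * cos ky) + ε

/-- `e_g` hybridisation `V_k = 2t γ_d` (same form for `V_k` with `t₃^{xz}` and `V′_k` with `t₄^{xz}`).
[cite: LuoEtAl2023, Eq. (2)] -/
def V (t kx ky : ℝ) : ℝ := 2 * t * γd kx ky

/-- The ten tight-binding parameters of the model. [cite: LuoEtAl2023, Table I] -/
structure Params where
  t1x : ℝ
  t1z : ℝ
  t2x : ℝ
  t2z : ℝ
  t3 : ℝ
  tperpx : ℝ
  tperpz : ℝ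
  t4 : ℝ
  εx : ℝ
  εz : ℝ

/-- The intra-layer block `H_A(k) = [[T^x, V], [V, T^z]]`. [cite: LuoEtAl2023, Eq. (2)] -/
def HA (p : Params) (kx ky : ℝ) : Matrix (Fin 2) (Fin 2) ℝ :=
  !![T p.t1x p.t2x p.εx kx ky, V p.t3 kx ky; V p.t3 kx ky, T p.t1z p.t2z p.εz kx ky]

/-- The inter-layer block `H_AB(k) = [[t^x_⊥, V′], [V′, t^z_⊥]]`. [cite: LuoEtAl2023, Eq. (2)] -/
def HAB (p : Params) (kx ky : ℝ) : Matrix (Fin 2) (Fin 2) ℝ :=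
  !![p.tperpx, V p.t4 kx ky; V p.t4 kx ky, p.tperpz]

/-- The `4 × 4` Bloch matrix in the basis `(Ax, Az | Bx, Bz)`: `[[H_A, H_AB], [H_AB, H_A]]`.
[cite: LuoEtAl2023, Eq. (2)] -/
def H (p : Params) (kx ky : ℝ) : Matrix (Fin 2 ⊕ Fin 2) (Fin 2 ⊕ Fin 2) ℝ :=
  fromBlocks (HA p kx ky) (HAB p kx ky) (HAB p kx ky) (HA p kx ky)

/-- The bonding (`s = 1`) / antibonding (`s = −1`) sector matrix `H_A + s·H_AB`. [cite: LuoEtAl2023, Eq. (3)] -/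
def Hsec (p : Params) (s kx ky : ℝ) : Matrix (Fin 2) (Fin 2) ℝ := HA p kx ky + s • HAB p kx ky

/-- The printed entries of `H_±`: `[[T^x ± t^x_⊥, V ± V′], [V ± V′, T^z ± t^z_⊥]]`. [cite: LuoEtAl2023, Eq. (3)] -/
theorem Hsec_eq (p : Params) (s kx ky : ℝ) :
    Hsec p s kx ky = !![T p.t1x p.t2x p.εx kx ky + s * p.tperpx, V p.t3 kx ky + s * V p.t4 kx ky;
      V p.t3 kx ky + s * V p.t4 kx ky, T p.t1z p.t2z p.εz kx ky + s * p.tperpz] := by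
  ext i j; fin_cases i <;> fin_cases j <;> simp [Hsec, HA, HAB, smul_eq_mul]

/-! ## 2. The mirror (bonding / antibonding) reduction — a block identity for any square blocks -/

section Mirror

variable {m : Type*}

/-- The unnormalised layer-mirror change of basis `P = [[1, 1], [1, −1]]` (blockwise); `P/√2` is the
bonding/antibonding rotation `Φ_± = (d_A ± d_B)/√2`. [cite: LuoEtAl2023, Eq. (3)] -/
def mirrorP (m : Type*) [DecidableEq m] : Matrix (m ⊕ m) (m ⊕ m) ℝ := fromBlocks 1 1 1 (-1)

/-- `P` is symmetric. [cite: LuoEtAl2023, Eq. (3)] -/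
theorem mirrorP_transpose [DecidableEq m] : (mirrorP m)ᵀ = mirrorP m := by
  simp [mirrorP, fromBlocks_transpose]

/-- `P² = 2·1`, i.e. `P/√2` is orthogonal. [cite: LuoEtAl2023, Eq. (3)] -/
theorem mirrorP_mul_self [Fintype m] [DecidableEq m] :
    mirrorP m * mirrorP m = (2 : ℝ) • (1 : Matrix (m ⊕ m) (m ⊕ m) ℝ) := by
  rw [mirrorP, fromBlocks_multiply, ← fromBlocks_one, fromBlocks_smul]
  congr 1 <;> simp [two_smul]

/-- **Mirror reduction**: `P · [[A, B], [B, A]] · P = 2 · [[A + B, 0], [0, A − B]]` for ANY square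
blocks `A, B`. [cite: LuoEtAl2023, Eq. (3)] -/
theorem mirror_conj [Fintype m] [DecidableEq m] (A B : Matrix m m ℝ) :
    mirrorP m * fromBlocks A B B A * mirrorP m = (2 : ℝ) • fromBlocks (A + B) 0 0 (A - B) := by
  rw [mirrorP, fromBlocks_multiply, fromBlocks_multiply, fromBlocks_smul]
  congr 1 <;> simp [two_smul] <;> abel

/-- The bonding sector is invariant: `[[A, B], [B, A]] (v, v) = ((A + B)v, (A + B)v)`. [cite: LuoEtAl2023, Eq. (3)] -/
theorem mulVec_bonding [Fintype m] (A B : Matrix m m ℝ) (v : m → ℝ) :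
    fromBlocks A B B A *ᵥ Sum.elim v v = Sum.elim ((A + B) *ᵥ v) ((A + B) *ᵥ v) := by
  rw [fromBlocks_mulVec]
  have h1 : Sum.elim v v ∘ Sum.inl = v := rfl
  have h2 : Sum.elim v v ∘ Sum.inr = v := rfl
  rw [h1, h2, add_mulVec, add_comm (B *ᵥ v)]

/-- The antibonding sector is invariant: `[[A, B], [B, A]] (v, −v) = ((A − B)v, (B − A)v) = ((A−B)v, −(A−B)v)`.
[cite: LuoEtAl2023, Eq. (3)] -/
theorem mulVec_antibonding [Fintype m] (A B : Matrix m m ℝ) (v : m → ℝ) :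
    fromBlocks A B B A *ᵥ Sum.elim v (-v) = Sum.elim ((A - B) *ᵥ v) ((B - A) *ᵥ v) := by
  rw [fromBlocks_mulVec]
  have h1 : Sum.elim v (-v) ∘ Sum.inl = v := rfl
  have h2 : Sum.elim v (-v) ∘ Sum.inr = -v := rfl
  rw [h1, h2, sub_mulVec, sub_mulVec, mulVec_neg, mulVec_neg, ← sub_eq_add_neg, ← sub_eq_add_neg]

end Mirror

/-- For the model: `P H(k) P = 2·[[H_+, 0], [0, H_−]]` with `H_± = H_A ± H_AB`. [cite: LuoEtAl2023, Eq. (3)] -/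
theorem mirror_conj_H (p : Params) (kx ky : ℝ) :
    mirrorP (Fin 2) * H p kx ky * mirrorP (Fin 2) =
      (2 : ℝ) • fromBlocks (Hsec p 1 kx ky) 0 0 (Hsec p (-1) kx ky) := by
  rw [H, mirror_conj]
  simp only [Hsec, one_smul, neg_smul, ← sub_eq_add_neg]

/-! ## 3. The symmetric two-level problem in closed form (the bands of each sector) -/

section TwoLevel

variable (a b v : ℝ)

/-- Upper level `λ_+ = (a+b)/2 + √(((a−b)/2)² + v²)` of `[[a, v], [v, b]]`. [cite: LuoEtAl2023, Eq. (3)] -/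
def lvlP : ℝ := (a + b) / 2 + √(((a - b) / 2) ^ 2 + v ^ 2)

/-- Lower level `λ_− = (a+b)/2 − √(((a−b)/2)² + v²)`. [cite: LuoEtAl2023, Eq. (3)] -/
def lvlM : ℝ := (a + b) / 2 - √(((a - b) / 2) ^ 2 + v ^ 2)

/-- Trace: `λ_+ + λ_− = a + b`. [cite: LuoEtAl2023, Eq. (3)] -/
theorem lvlP_add_lvlM : lvlP a b v + lvlM a b v = a + b := by
  simp only [lvlP, lvlM]; ring

/-- Determinant: `λ_+ λ_− = ab − v²`. [cite: LuoEtAl2023, Eq. (3)] -/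
theorem lvlP_mul_lvlM : lvlP a b v * lvlM a b v = a * b - v ^ 2 := by
  have h : √(((a - b) / 2) ^ 2 + v ^ 2) ^ 2 = ((a - b) / 2) ^ 2 + v ^ 2 := Real.sq_sqrt (by positivity)
  simp only [lvlP, lvlM]
  nlinarith [h]

/-- Both levels are eigenvalues: `det([[a, v], [v, b]] − λ·1) = 0`. [cite: LuoEtAl2023, Eq. (3)] -/
theorem det_sub_lvl_eq_zero :
    Matrix.det !![a - lvlP a b v, v; v, b - lvlP a b v] = 0 ∧
      Matrix.det !![a - lvlM a b v, v; v, b - lvlM a b v] = 0 := by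
  have hs := lvlP_add_lvlM a b v
  have hp := lvlP_mul_lvlM a b v
  rw [Matrix.det_fin_two_of, Matrix.det_fin_two_of]
  exact ⟨by linear_combination (lvlP a b v) * hs - hp, by linear_combination (lvlM a b v) * hs - hp⟩

/-- Splitting: `λ_+ − λ_− = 2√(((a−b)/2)² + v²) ≥ |a − b|` — hybridisation only widens the gap between the
two levels. [cite: LuoEtAl2023, Eq. (3)] -/
theorem lvlP_sub_lvlM : lvlP a b v - lvlM a b v = 2 * √(((a - b) / 2) ^ 2 + v ^ 2) ∧
    |a - b| ≤ lvlP a b v - lvlM a b v := by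
  have h1 : lvlP a b v - lvlM a b v = 2 * √(((a - b) / 2) ^ 2 + v ^ 2) := by
    simp only [lvlP, lvlM]; ring
  refine ⟨h1, ?_⟩
  rw [h1]
  have h2 : |a - b| = 2 * √(((a - b) / 2) ^ 2) := by
    rw [Real.sqrt_sq_eq_abs, abs_div, abs_two]; ring
  rw [h2]
  gcongr
  nlinarith [sq_nonneg v]

/-- Level repulsion: `λ_− ≤ min(a, b)` and `max(a, b) ≤ λ_+`. [cite: LuoEtAl2023, Eq. (3)] -/
theorem lvlM_le_min_max_le_lvlP : lvlM a b v ≤ min a b ∧ max a b ≤ lvlP a b v := by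
  have hroot : |a - b| / 2 ≤ √(((a - b) / 2) ^ 2 + v ^ 2) := by
    have : |a - b| / 2 = √((|a - b| / 2) ^ 2) := (Real.sqrt_sq (by positivity)).symm
    rw [this]
    gcongr
    rw [div_pow, sq_abs, ← div_pow]
    nlinarith [sq_nonneg v]
  have hab := abs_sub_comm a b
  constructor
  · rw [lvlM, le_min_iff]
    constructor
    · cases abs_cases (a - b) <;> linarith
    · cases abs_cases (a - b) <;> linarith
  · rw [lvlP, max_le_iff]
    constructor
    · cases abs_cases (a - b) <;> linarith
    · cases abs_cases (a - b) <;> linarith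

/-- Decoupling: at `v = 0` the levels are `max(a,b)` and `min(a,b)`. [cite: LuoEtAl2023, Eq. (3)] -/
theorem lvl_of_zero : lvlP a b 0 = max a b ∧ lvlM a b 0 = min a b := by
  have h : √(((a - b) / 2) ^ 2 + (0:ℝ) ^ 2) = |a - b| / 2 := by
    rw [zero_pow two_ne_zero, add_zero, Real.sqrt_sq_eq_abs, abs_div, abs_two]
  simp only [lvlP, lvlM, h]
  constructor
  · rcases le_total a b with hab | hab
    · rw [max_eq_right hab, abs_of_nonpos (by linarith)]; ring
    · rw [max_eq_left hab, abs_of_nonneg (by linarith)]; ring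
  · rcases le_total a b with hab | hab
    · rw [min_eq_left hab, abs_of_nonpos (by linarith)]; ring
    · rw [min_eq_right hab, abs_of_nonneg (by linarith)]; ring

end TwoLevel

/-! ## 4. Consequences for the model: zone diagonals, the `2t^z_⊥` splitting -/

/-- On the zone diagonal `k_y = k_x` the hybridisations vanish, so each sector matrix is diagonal:
its bands are exactly `T^x ± t^x_⊥` and `T^z ± t^z_⊥`. [cite: LuoEtAl2023, Eq. (3)] -/
theorem Hsec_diag (p : Params) (s k : ℝ) :
    Hsec p s k k = !![T p.t1x p.t2x p.εx k k + s * p.tperpx, 0; 0, T p.t1z p.t2z p.εz k k + s * p.tperpz] := by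
  rw [Hsec_eq]; simp [V, γd_diag]

/-- Same on the anti-diagonal `k_y = −k_x`. [cite: LuoEtAl2023, Eq. (3)] -/
theorem Hsec_antidiag (p : Params) (s k : ℝ) :
    Hsec p s k (-k) =
      !![T p.t1x p.t2x p.εx k (-k) + s * p.tperpx, 0; 0, T p.t1z p.t2z p.εz k (-k) + s * p.tperpz] := by
  rw [Hsec_eq]; simp [V, γd_antidiag]

/-- «The two `d_{3z²−r²}` states … define a splitting energy `2t^z_⊥`»: the `z`-diagonal entries of
`H_+` and `H_−` differ by exactly `2t^z_⊥` at every `k` (and the `x` entries by `2t^x_⊥`).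
[cite: LuoEtAl2023, Eq. (3)] -/
theorem z_splitting (p : Params) (kx ky : ℝ) :
    Hsec p 1 kx ky 1 1 - Hsec p (-1) kx ky 1 1 = 2 * p.tperpz ∧
      Hsec p 1 kx ky 0 0 - Hsec p (-1) kx ky 0 0 = 2 * p.tperpx := by
  simp [Hsec_eq]; constructor <;> ring

/-- On the diagonal the two `z`-type bands of the FULL problem are `T^z(k,k) ± t^z_⊥`, split by
`2|t^z_⊥|` with no `x`-admixture (the sector levels decouple, `lvl_of_zero`). [cite: LuoEtAl2023, Eq. (3)] -/
theorem z_bands_diag (p : Params) (k : ℝ) :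
    (T p.t1z p.t2z p.εz k k + p.tperpz) - (T p.t1z p.t2z p.εz k k - p.tperpz) = 2 * p.tperpz := by
  ring

/-! ## 5. Why `γ_d`: the `e_g` sign rules from the Slater–Koster table, and the Bloch sums -/

/-- Oxygen-mediated `x–z` path on a straight `x` bond versus a `y` bond: OPPOSITE signs
(`(√3/2·V)(−½V)` vs `(−√3/2·V)(−½V)`). [cite: SlaterKoster1954, Table I] -/
theorem sk_xz_path_sign {l m : ℝ} (hl : l ^ 2 = 1) (hm : m ^ 2 = 1) (Vσ Vπ : ℝ) :
    SlaterKoster.xX2Y2 l 0 Vσ Vπ * SlaterKoster.xZ2 l 0 0 Vσ Vπ =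
      -(SlaterKoster.yX2Y2 0 m Vσ Vπ * SlaterKoster.yZ2 0 m 0 Vσ Vπ) := by
  rw [SlaterKoster.xX2Y2_xbond hl, SlaterKoster.xZ2_xbond hl, SlaterKoster.yX2Y2_ybond hm,
    SlaterKoster.yZ2_ybond hm]
  linear_combination (-(√3 / 4 * Vσ ^ 2)) * hl + (√3 / 4 * Vσ ^ 2) * hm

/-- Oxygen-mediated `x–x` and `z–z` paths: SAME value on `x` and `y` bonds (`¾V²` and `¼V²`).
[cite: SlaterKoster1954, Table I] -/
theorem sk_xx_zz_path_sign {l m : ℝ} (hl : l ^ 2 = 1) (hm : m ^ 2 = 1) (Vσ Vπ : ℝ) :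
    SlaterKoster.xX2Y2 l 0 Vσ Vπ ^ 2 = SlaterKoster.yX2Y2 0 m Vσ Vπ ^ 2 ∧
      SlaterKoster.xZ2 l 0 0 Vσ Vπ ^ 2 = SlaterKoster.yZ2 0 m 0 Vσ Vπ ^ 2 := by
  rw [SlaterKoster.xX2Y2_xbond hl, SlaterKoster.xZ2_xbond hl, SlaterKoster.yX2Y2_ybond hm,
    SlaterKoster.yZ2_ybond hm]
  constructor
  · linear_combination (√3 ^ 2 / 4 * Vσ ^ 2) * hl - (√3 ^ 2 / 4 * Vσ ^ 2) * hm
  · linear_combination (1 / 4 * Vσ ^ 2) * hl - (1 / 4 * Vσ ^ 2) * hm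

/-- The DIRECT `d–d` Slater–Koster elements obey the same rule: `E_{x²−y²,3z²−r²}` flips sign between
the `x` and `y` bonds, `E_{x²−y²,x²−y²}` and `E_{3z²−r²,3z²−r²}` do not. [cite: SlaterKoster1954, Table I] -/
theorem sk_direct_signs (Vσ Vπ Vδ : ℝ) :
    SlaterKoster.x2y2Z2 1 0 0 Vσ Vπ Vδ = -SlaterKoster.x2y2Z2 0 1 0 Vσ Vπ Vδ ∧
      SlaterKoster.x2y2X2Y2 1 0 0 Vσ Vπ Vδ = SlaterKoster.x2y2X2Y2 0 1 0 Vσ Vπ Vδ ∧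
      SlaterKoster.z2Z2 1 0 0 Vσ Vπ Vδ = SlaterKoster.z2Z2 0 1 0 Vσ Vπ Vδ := by
  simp only [SlaterKoster.x2y2Z2, SlaterKoster.x2y2X2Y2, SlaterKoster.z2Z2]
  refine ⟨by ring, by ring, by ring⟩

/-- Nearest-neighbour Bloch sum with amplitude `t_x` on the `±x̂` bonds and `t_y` on the `±ŷ` bonds
(each pair of opposite bonds contributes `2t cos k`). [cite: LuoEtAl2023, Eq. (2)] -/
def nnBloch (tx ty kx ky : ℝ) : ℝ := tx * (2 * cos kx) + ty * (2 * cos ky)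

/-- Equal signs on `x` and `y` bonds ⇒ the `s`-wave form factor `2t γ_s` (the `T` entries).
[cite: LuoEtAl2023, Eq. (2)] -/
theorem nnBloch_same (t kx ky : ℝ) : nnBloch t t kx ky = 2 * t * γs kx ky := by
  simp only [nnBloch, γs]; ring

/-- Opposite signs on `x` and `y` bonds ⇒ the `d`-wave form factor `2t γ_d` (the `V, V′` entries,
«associated to the orbital symmetry of two `e_g` sectors»). [cite: LuoEtAl2023, Eq. (2)] -/
theorem nnBloch_opposite (t kx ky : ℝ) : nnBloch t (-t) kx ky = 2 * t * γd kx ky := by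
  simp only [nnBloch, γd]; ring

/-- Hence `V = nnBloch t₃ (−t₃)` and the `t₁` part of `T` is `nnBloch t₁ t₁`. [cite: LuoEtAl2023, Eq. (2)] -/
theorem V_eq_nnBloch (t kx ky : ℝ) : V t kx ky = nnBloch t (-t) kx ky := by
  rw [nnBloch_opposite, V]

/-! ## 6. The printed parameter set and the printed comparisons -/

/-- Table I of Luo et al. (eV): `t₁^x, t₁^z, t₂^x, t₂^z, t₃^{xz}, t^x_⊥, t^z_⊥, t₄^{xz}, ε^x, ε^z`.
[cite: LuoEtAl2023, Table I] -/
def luo2023 : Params :=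
  ⟨-0.483, -0.110, 0.069, -0.017, 0.239, 0.005, -0.635, -0.034, 0.776, 0.409⟩

/-- «`t^z_⊥ = −0.635` is even larger than … `t₁^x = −0.483`, by a ratio of 1.3»: the ratio lies in
`(1.31, 1.32)`. [cite: LuoEtAl2023, Table I] -/
theorem luo2023_ratio : (1.31 : ℝ) < luo2023.tperpz / luo2023.t1x ∧ luo2023.tperpz / luo2023.t1x < 1.32 := by
  simp only [luo2023]; norm_num

/-- The `d_{3z²−r²}` bonding–antibonding splitting `2|t^z_⊥| = 1.27` eV. [cite: LuoEtAl2023, Table I] -/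
theorem luo2023_z_splitting : 2 * |luo2023.tperpz| = 1.27 := by
  simp only [luo2023]; norm_num [abs_of_neg]

/-- «for `d_{x²−y²}` the amplitude `t^x_⊥ = 0.005` is marginal»: below `1 %` of `|t^z_⊥|` (the
shared apical `p_z` couples to `d_{3z²−r²}` only — `SlaterKoster.apical`). [cite: LuoEtAl2023, Table I] -/
theorem luo2023_tperpx_marginal : |luo2023.tperpx| < 0.01 * |luo2023.tperpz| := by
  simp only [luo2023]; norm_num [abs_of_neg, abs_of_pos]

/-- The inter-layer hybridisation is an order of magnitude below the intra-layer one: `|t₄/t₃| < 0.15`.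
[cite: LuoEtAl2023, Table I] -/
theorem luo2023_t4_small : |luo2023.t4 / luo2023.t3| < 0.15 := by
  simp only [luo2023]; norm_num [abs_of_neg, abs_of_pos, abs_div]

/-! ## §7 Zone averages of the form factors (square Brillouin zone `[0, 2π]²`, measure `(2π)²`)

The entries of [LuoEtAl2023, Eq. (2)] are trigonometric polynomials, so their Brillouin-zone
averages are elementary period integrals: `⟨γ_s⟩ = ⟨γ_d⟩ = ⟨cos k_x cos k_y⟩ = 0`,
`⟨γ_s²⟩ = ⟨γ_d²⟩ = 1`, `⟨γ_s γ_d⟩ = 0`; hence the zone average of the intra-orbital dispersion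
`T^{x/z}_k` is exactly the site energy `ε^{x/z}`, and the root-mean-square of the `e_g` hybridisation
`V_k = 2t₃ γ_d` is `2|t₃|`, one half of its maximum `4|t₃|` (attained at `X = (π, 0)`); for the
normalised `d`-wave factor `γ_d/2 = (cos k_x − cos k_y)/2` the mean square is `¼` (value `1` at `X`,
`0` on the zone diagonals).  Every statement below is an exact iterated interval integral
`∫₀^{2π}∫₀^{2π} … = (2π)² · ⟨…⟩`. -/

section ZoneAverages

/-- `∫₀^{2π} cos = 0` (plumbing). [folklore] -/
private theorem integral_cos_period : ∫ y in (0:ℝ)..2 * π, cos y = 0 := by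
  rw [integral_cos]; simp

/-- `∫₀^{2π} cos² = π` (plumbing). [folklore] -/
private theorem integral_cos_sq_period : ∫ y in (0:ℝ)..2 * π, cos y ^ 2 = π := by
  rw [integral_cos_sq]; simp

/-- interval integrability of a constant on `[0, 2π]` (plumbing). [folklore] -/
private theorem ii_const (c : ℝ) : IntervalIntegrable (fun _ : ℝ => c) volume 0 (2 * π) :=
  intervalIntegrable_const

/-- interval integrability of `c cos` on `[0, 2π]` (plumbing). [folklore] -/
private theorem ii_mul_cos (c : ℝ) :
    IntervalIntegrable (fun y : ℝ => c * cos y) volume 0 (2 * π) :=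
  (continuous_const.mul continuous_cos).intervalIntegrable _ _

/-- interval integrability of `cos²` on `[0, 2π]` (plumbing). [folklore] -/
private theorem ii_cos_sq : IntervalIntegrable (fun y : ℝ => cos y ^ 2) volume 0 (2 * π) :=
  (continuous_cos.pow 2).intervalIntegrable _ _

/-- interval integrability of `c cos²` on `[0, 2π]` (plumbing). [folklore] -/
private theorem ii_mul_cos_sq (c : ℝ) :
    IntervalIntegrable (fun y : ℝ => c * cos y ^ 2) volume 0 (2 * π) :=
  (continuous_const.mul (continuous_cos.pow 2)).intervalIntegrable _ _

/-- Inner (`k_y`) period integral of `γ_d² = (cos k_x − cos k_y)²`.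
[cite: LuoEtAl2023, Eq. (2)] (form factor; the integral is elementary) -/
theorem integral_γd_sq_inner (x : ℝ) :
    ∫ y in (0:ℝ)..2 * π, γd x y ^ 2 = 2 * π * cos x ^ 2 + π := by
  have h : ∀ y, γd x y ^ 2 = (cos x ^ 2 - 2 * cos x * cos y) + cos y ^ 2 := by
    intro y; simp only [γd]; ring
  simp_rw [h]
  rw [integral_add ((ii_const _).sub (ii_mul_cos _)) ii_cos_sq,
    integral_sub (ii_const _) (ii_mul_cos _), intervalIntegral.integral_const,
    intervalIntegral.integral_const_mul, integral_cos_period, integral_cos_sq_period]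
  simp

/-- Inner (`k_y`) period integral of `γ_s² = (cos k_x + cos k_y)²`.
[cite: LuoEtAl2023, Eq. (2)] (form factor; the integral is elementary) -/
theorem integral_γs_sq_inner (x : ℝ) :
    ∫ y in (0:ℝ)..2 * π, γs x y ^ 2 = 2 * π * cos x ^ 2 + π := by
  have h : ∀ y, γs x y ^ 2 = (cos x ^ 2 + 2 * cos x * cos y) + cos y ^ 2 := by
    intro y; simp only [γs]; ring
  simp_rw [h]
  rw [integral_add ((ii_const _).add (ii_mul_cos _)) ii_cos_sq,
    integral_add (ii_const _) (ii_mul_cos _), intervalIntegral.integral_const,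
    intervalIntegral.integral_const_mul, integral_cos_period, integral_cos_sq_period]
  simp

/-- Inner period integral of `γ_s γ_d = cos² k_x − cos² k_y`.
[cite: LuoEtAl2023, Eq. (2)] (form factors; the integral is elementary) -/
theorem integral_γs_mul_γd_inner (x : ℝ) :
    ∫ y in (0:ℝ)..2 * π, γs x y * γd x y = 2 * π * cos x ^ 2 - π := by
  have h : ∀ y, γs x y * γd x y = cos x ^ 2 - cos y ^ 2 := by
    intro y; simp only [γs, γd]; ring
  simp_rw [h]
  rw [integral_sub (ii_const _) ii_cos_sq, intervalIntegral.integral_const, integral_cos_sq_period]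
  simp

/-- Inner period integrals of `γ_s`, `γ_d` and of the second-neighbour factor `cos k_x cos k_y`.
[cite: LuoEtAl2023, Eq. (2)] (form factors; the integrals are elementary) -/
theorem integral_γ_inner (x : ℝ) :
    (∫ y in (0:ℝ)..2 * π, γs x y) = 2 * π * cos x ∧ (∫ y in (0:ℝ)..2 * π, γd x y) = 2 * π * cos x ∧
    (∫ y in (0:ℝ)..2 * π, cos x * cos y) = 0 := by
  refine ⟨?_, ?_, ?_⟩
  · have h : ∀ y, γs x y = cos x + cos y := fun y => rfl
    simp_rw [h]
    rw [integral_add (ii_const _) (continuous_cos.intervalIntegrable _ _),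
      intervalIntegral.integral_const, integral_cos_period]
    simp
  · have h : ∀ y, γd x y = cos x - cos y := fun y => rfl
    simp_rw [h]
    rw [integral_sub (ii_const _) (continuous_cos.intervalIntegrable _ _),
      intervalIntegral.integral_const, integral_cos_period]
    simp
  · rw [intervalIntegral.integral_const_mul, integral_cos_period]; simp

/-- `⟨γ_d²⟩ = 1`: `∫₀^{2π}∫₀^{2π} (cos k_x − cos k_y)² = (2π)² · 1`.
[cite: LuoEtAl2023, Eq. (2)] (form factor of `V_k, V′_k`; the average is elementary) -/
theorem integral_γd_sq :
    ∫ x in (0:ℝ)..2 * π, ∫ y in (0:ℝ)..2 * π, γd x y ^ 2 = (2 * π) ^ 2 * 1 := by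
  simp_rw [integral_γd_sq_inner]
  rw [integral_add (ii_mul_cos_sq _) (ii_const _), intervalIntegral.integral_const_mul,
    integral_cos_sq_period, intervalIntegral.integral_const]
  simp; ring

/-- `⟨γ_s²⟩ = 1`: `∫₀^{2π}∫₀^{2π} (cos k_x + cos k_y)² = (2π)² · 1`.
[cite: LuoEtAl2023, Eq. (2)] (form factor of `T_k`; the average is elementary) -/
theorem integral_γs_sq :
    ∫ x in (0:ℝ)..2 * π, ∫ y in (0:ℝ)..2 * π, γs x y ^ 2 = (2 * π) ^ 2 * 1 := by
  simp_rw [integral_γs_sq_inner]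
  rw [integral_add (ii_mul_cos_sq _) (ii_const _), intervalIntegral.integral_const_mul,
    integral_cos_sq_period, intervalIntegral.integral_const]
  simp; ring

/-- `⟨γ_s γ_d⟩ = 0`: the `s`- and `d`-wave form factors are orthogonal on the zone.
[cite: LuoEtAl2023, Eq. (2)] (form factors; the average is elementary) -/
theorem integral_γs_mul_γd :
    ∫ x in (0:ℝ)..2 * π, ∫ y in (0:ℝ)..2 * π, γs x y * γd x y = 0 := by
  simp_rw [integral_γs_mul_γd_inner]
  rw [integral_sub (ii_mul_cos_sq _) (ii_const _), intervalIntegral.integral_const_mul,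
    integral_cos_sq_period, intervalIntegral.integral_const]
  simp

/-- `⟨γ_s⟩ = ⟨γ_d⟩ = ⟨cos k_x cos k_y⟩ = 0`.
[cite: LuoEtAl2023, Eq. (2)] (form factors; the averages are elementary) -/
theorem integral_γ :
    (∫ x in (0:ℝ)..2 * π, ∫ y in (0:ℝ)..2 * π, γs x y) = 0 ∧
    (∫ x in (0:ℝ)..2 * π, ∫ y in (0:ℝ)..2 * π, γd x y) = 0 ∧
    (∫ x in (0:ℝ)..2 * π, ∫ y in (0:ℝ)..2 * π, cos x * cos y) = 0 := by
  refine ⟨?_, ?_, ?_⟩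
  · simp_rw [(integral_γ_inner _).1]
    rw [intervalIntegral.integral_const_mul, integral_cos_period]; simp
  · simp_rw [(integral_γ_inner _).2.1]
    rw [intervalIntegral.integral_const_mul, integral_cos_period]; simp
  · simp_rw [(integral_γ_inner _).2.2]; simp

/-- THE ZONE AVERAGE OF THE INTRA-ORBITAL DISPERSION IS THE SITE ENERGY:
`∫₀^{2π}∫₀^{2π} T^{x/z}_k = (2π)² · ε^{x/z}` (`⟨γ_s⟩ = ⟨cos k_x cos k_y⟩ = 0`), i.e. the printed
`ε^x = 0.776`, `ε^z = 0.409` eV are the band centres of gravity of `T^x_k`, `T^z_k`.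
[cite: LuoEtAl2023, Eq. (2) and Table I] -/
theorem integral_T (t1 t2 ε : ℝ) :
    ∫ x in (0:ℝ)..2 * π, ∫ y in (0:ℝ)..2 * π, T t1 t2 ε x y = (2 * π) ^ 2 * ε := by
  have hin : ∀ x, ∫ y in (0:ℝ)..2 * π, T t1 t2 ε x y = (4 * π * t1) * cos x + 2 * π * ε := by
    intro x
    have h : ∀ y, T t1 t2 ε x y = ((2 * t1 * cos x + ε) + (2 * t1 + 4 * t2 * cos x) * cos y) := by
      intro y; simp only [T, γs]; ring
    simp_rw [h]
    rw [integral_add (ii_const _) (ii_mul_cos _), intervalIntegral.integral_const,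
      intervalIntegral.integral_const_mul, integral_cos_period]
    simp; ring
  simp_rw [hin]
  rw [integral_add (ii_mul_cos _) (ii_const _), intervalIntegral.integral_const_mul,
    integral_cos_period, intervalIntegral.integral_const]
  simp; ring

/-- The `e_g` hybridisation at `X = (π, 0)`: `V_X = 2t(cos π − cos 0) = −4t`, and `|V_k| ≤ 4|t|`
everywhere. [cite: LuoEtAl2023, Eq. (2)] -/
theorem V_at_X (t : ℝ) : V t π 0 = -(4 * t) ∧ ∀ kx ky, |V t kx ky| ≤ 4 * |t| := by
  refine ⟨by simp [V, γd]; ring, fun kx ky => ?_⟩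
  have h := abs_γd_le kx ky
  simp only [V, abs_mul, abs_two]
  nlinarith [abs_nonneg t]

/-- `⟨V_k²⟩ = 4t²`: `∫₀^{2π}∫₀^{2π} V_k² = (2π)² · 4t²` — the root-mean-square `e_g` hybridisation is
`2|t₃|`, one half of its zone maximum `4|t₃|` (`V_at_X`); with the printed `t₃^{xz} = 0.239` eV the
rms is `0.478` eV. [cite: LuoEtAl2023, Eq. (2) and Table I] -/
theorem integral_V_sq (t : ℝ) :
    ∫ x in (0:ℝ)..2 * π, ∫ y in (0:ℝ)..2 * π, V t x y ^ 2 = (2 * π) ^ 2 * (4 * t ^ 2) := by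
  have h : ∀ x y, V t x y ^ 2 = (4 * t ^ 2) * γd x y ^ 2 := by intro x y; simp only [V]; ring
  simp_rw [h, intervalIntegral.integral_const_mul, integral_γd_sq]
  ring

/-- The normalised `d`-wave factor `v_k = (cos k_x − cos k_y)/2` (value `±1` at `X`, `0` on the zone
diagonals): `⟨v²⟩ = ¼`, i.e. `∫₀^{2π}∫₀^{2π} v_k² = (2π)² · ¼` — a zone AVERAGE of a `v²`-weighted
quantity carries the factor `¼`, not the sup-norm `1`. [cite: LuoEtAl2023, Eq. (2)] -/
theorem integral_half_γd_sq :
    (∫ x in (0:ℝ)..2 * π, ∫ y in (0:ℝ)..2 * π, (γd x y / 2) ^ 2 = (2 * π) ^ 2 * (1 / 4)) ∧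
    (γd π 0 / 2) ^ 2 = 1 ∧ ∀ k, (γd k k / 2) ^ 2 = 0 := by
  refine ⟨?_, by simp [γd]; norm_num, fun k => by simp [γd_diag]⟩
  have h : ∀ x y, (γd x y / 2) ^ 2 = (1 / 4) * γd x y ^ 2 := by intro x y; ring
  simp_rw [h, intervalIntegral.integral_const_mul, integral_γd_sq]
  ring

end ZoneAverages

end BilayerTwoOrbital

end Literature.MathematicalPhysics.QuantumLattice

end
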